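import Literature.MathematicalPhysics.QuantumFieldTheory.Federbush1986.PlaquetteStokes
import Literature.MathematicalPhysics.QuantumFieldTheory.Federbush1986.PlaquetteConsistency
import Literature.MathematicalPhysics.QuantumFieldTheory.Federbush1986.NonAbelianDualityEq31Proof

/-!
# `Federbush1986.LinearCascadePlaquette` — the plaquette variables of the LINEAR (abelian) block-spin cascade of the top
# datum (7) of [Federbush1987PhaseCellVI] converge to the cube-averaged flux (1.13) of [Federbush1986PhaseCellI], with the
# rate `792·B₂·ℓ_s·ℓ_{r₀}`; Lie-algebra-valued configurations (any complete normed space), by duality from the real theory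

statement-level skeleton of published theorems with citation tags; proofs where landed; nothing here is a claim about the Yang–Mills mass gap

CITATION HEADER.  P. Federbush, *A phase cell approach to Yang–Mills theory. VI. Non-abelian lattice-continuum duality*,
Ann. Inst. H. Poincaré **47** (1987) 17–23 [Federbush1987PhaseCellVI]: (7) p. 19 (`g₀(e, A) = exp ∫_e A·ds`), (11)–(12)
p. 20, (14) p. 21 «F^L is exactly the linear portion of the transformation, made up of the linear terms in (14) … the linear
terms are the abelian theory of I», (24) p. 22, (32)/Theorem 2 p. 20–23; P. Federbush, *… I*, Commun. Math. Phys. **107**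
(1986) 319–329 [Federbush1986PhaseCellI]: (1.5) p. 322 (plaquette of the averaged bonds), (1.13)–(1.14) p. 324 («The
assignments via Eq. (1.13) automatically satisfy the consistency requirements, of Balaban averaging»), (2.9)–(2.12) p. 326.
Unit `lit-balaban-r17` gen 4 (fold owner of the Federbush block); SKELETON rows **F6.Thm2** (ingredient requested by seat
r19 gen 5, HOME/lit-balaban-r17/INBOX 2026-08-21T05:25:32Z (3)), **F1.Eq1.13**, **F6.Eq24-25** of
`run/shared/lean/pub/lit-balaban/lit-balaban-r17/SKELETON-r17.md`.

THE MATHEMATICS.  Let `λ_r(e) = ∫₀^{ℓ_r} A_{dir e}(src e + t u_{dir e}) dt` be the logarithmic top datum (7) (`logData`) of a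
`C¹` potential with values in a complete normed space `V` (the Lie algebra), `‖∂_νA_μ‖ ≤ B₂`, and let `L = avStep` be the
linear part of Federbush's block spin = the axial-tree (Bałaban) average (`AxialTreeV`, `FL_vars_eq_avStep` of
`NonAbelianDualityEq25Proof`).  CLAIM: for a level-`s` plaquette `p` and `r₀ = s + k`,
`‖plaq(L^k λ_{r₀})(p) − P_s(p)‖ ≤ 792·B₂·ℓ_s·ℓ_{r₀}`, where `P_s(p) = ∫_{u∈[0,1]⁴} ∮_{□(src p + ℓ_s u)} A` is the
`V`-valued continuum plaquette functional (1.13).  PROOF (duality): for every continuous linear `φ : V → ℝ`, `φ` commutes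
with the line integrals and with `L` (real coefficients), so `φ(plaq(L^kλ)(p))` is the plaquette of the REAL cascade of
the line data of the real potential `A_φ = φ∘A` (`|∂A_φ| ≤ ‖φ‖B₂`), and `φ(P_s(p)) = P_s[A_φ](p)`.  In the real theory:
(a) EXACTNESS `plaqOfBonds_bondApprox` (p245853): the cascade of I's tent-smeared datum `approxTop_{r₀}A_φ` has plaquette
values EXACTLY `P_s[A_φ]`; (b) the two level-`r₀` data differ edgewise by `≤ 22(‖φ‖B₂)ℓ_{r₀}²` (both are within
`2B′ℓ²`, resp. `20B′ℓ²`, of `ℓ·A_φ(src)`: `abs_lineInt_sub_mul_le`, `abs_approxTop_sub_const_le` p245453); (c) `L^k` is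
linear with `‖L^k c‖_∞ ≤ 9·2^k‖c‖_∞` (`AxialTreeV.norm_iterate_avStep_le`, (2.9) with c = 9); a plaquette reads four
bonds: `|φ(…)| ≤ 4·9·2^k·22‖φ‖B₂ℓ_{r₀}² = 792‖φ‖B₂ℓ_sℓ_{r₀}`; Hahn–Banach (`norm_le_dual_bound`) removes `φ`.
By the same duality, the `V`-valued tree-leg cancellation `plaqV_avStep` ((1.5), abelian) follows from the real one.

WHAT THIS MODULE PROVIDES (plumbing defs `lineIntV`, `loopIntV`, `plaqFunctionalV`, `lineData`, `AxialTreeV.plaqV`,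
`dualPot`; no `Prop` definition, no named fact; axioms standard): `AxialTreeV.apply_plaqV`, `AxialTreeV.plaqV_sub`,
`AxialTree.avStep_eq_avStepV`, `AxialTree.iterate_avStep_eq`, **`AxialTreeV.plaqV_avStep`**, `contDiff_dualPot`,
`pd_dualPot`, `abs_pd_dualPot_le`, `apply_lineIntV`, `apply_loopIntV`, `apply_plaqFunctionalV`, `abs_lineInt_sub_mul_le`,
`abs_lineData_sub_approxTop_le`, **`abs_plaq_av_lineData_sub_plaqFunctional_le`** (real rate),
**`AxialTreeV.norm_plaqV_cascade_lineData_sub_le`** (V-valued rate), **`AxialTreeV.tendsto_plaqV_cascade_lineData`**,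
**`BlockSpinSystem.norm_plaq_linearCascade_logData_sub_le`**, **`BlockSpinSystem.tendsto_plaq_linearCascade_logData`**
(the statement requested by r19, for every `C¹` potential with bounded axis derivatives).
-/

namespace Literature.MathematicalPhysics.QuantumFieldTheory.Federbush1986

noncomputable section

open MeasureTheory Filter Set intervalIntegral
open scoped Topology BigOperators

/-! ## §1 `V`-valued line and loop integrals, the plaquette functional (1.13), the top datum (7) -/

section Defs

variable {V : Type*} [NormedAddCommGroup V] [NormedSpace ℝ V]

/-- `∫₀^ℓ A_i(x + t e_i) dt` with values in `V` (the logarithm (7) of `g₀` along a segment). [cite: Federbush1987PhaseCellVI,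
(7) p. 19; Federbush1986PhaseCellI, (1.13) p. 324] -/
def lineIntV (A : E4 → Fin 4 → V) (x : E4) (i : Fin 4) (ℓ : ℝ) : V := ∫ t in (0 : ℝ)..ℓ, A (x + t • unitVec i) i

/-- `∮_{∂□} A·ds` around the square with corner `x`, sides `ℓe_i`, `ℓe_j`, values in `V` (edge order of `plaqOfBonds` /
`plaqHol`). [cite: Federbush1986PhaseCellI, (1.13) p. 324; Federbush1987PhaseCellVI, (10) p. 20] -/
def loopIntV (A : E4 → Fin 4 → V) (x : E4) (i j : Fin 4) (ℓ : ℝ) : V :=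
  lineIntV A x i ℓ + lineIntV A (x + ℓ • unitVec i) j ℓ - lineIntV A (x + ℓ • unitVec j) i ℓ - lineIntV A x j ℓ

/-- The `V`-valued continuum plaquette functional (1.13)–(1.14): the unit-cube average of the loop integrals around the
translates of the plaquette. [cite: Federbush1986PhaseCellI, (1.12)–(1.14) p. 324] -/
def plaqFunctionalV (s : ℕ) (A : E4 → Fin 4 → V) (p : Plaq s) : V :=
  ∫ u in Icc (0 : Fin 4 → ℝ) 1, loopIntV A (p.src + latLen s • mkPt u) p.dir₁ p.dir₂ (latLen s)

/-- The level-`r` top datum (7)/(11): `λ_r(e) = ∫_e A·ds` (`= BlockSpinSystem.logData`). [cite: Federbush1987PhaseCellVI,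
(7) p. 19, (11) p. 20] -/
def lineData (A : E4 → Fin 4 → V) (r : ℕ) (e : Edge r) : V := lineIntV A e.src e.dir (latLen r)

/-- The real potential `A_φ = φ ∘ A` seen through a continuous linear functional. [cite: Federbush1987PhaseCellVI, (14),
(24) p. 21–22] -/
def dualPot (φ : V →L[ℝ] ℝ) (A : E4 → Fin 4 → V) : E4 → Fin 4 → ℝ := fun x μ => φ (A x μ)

end Defs

namespace AxialTreeV

section Algebra

variable {V : Type*} [AddCommGroup V]

/-- The plaquette variable `A_∂p = A(e₁) + A(e₂) − A(e₃) − A(e₄)` of a `V`-valued configuration (abelian/logarithmic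
form of `g_∂p`). [cite: Federbush1986PhaseCellI, (1.4) p. 322; Federbush1987PhaseCellVI, (10) p. 20] -/
def plaqV (c : Cfg V) {s : ℕ} (p : Plaq s) : V :=
  c p.base p.dir₁ + c (p.base + Pi.single p.dir₁ 1) p.dir₂ - c (p.base + Pi.single p.dir₂ 1) p.dir₁ - c p.base p.dir₂

/-- `plaqV` is additive under subtraction of configurations. [cite: Federbush1986PhaseCellI, (1.4) p. 322] -/
theorem plaqV_sub (c d : Cfg V) {s : ℕ} (p : Plaq s) : plaqV (c - d) p = plaqV c p - plaqV d p := by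
  simp only [plaqV, Pi.sub_apply]; abel

/-- A linear functional of the `V`-valued plaquette variable is the real plaquette variable of the functional's values.
[cite: Federbush1987PhaseCellVI, (14), (24) p. 21–22; Federbush1986PhaseCellI, (1.4) p. 322] -/
theorem apply_plaqV [Module ℝ V] (φ : V →ₗ[ℝ] ℝ) (c : Cfg V) {s : ℕ} (p : Plaq s) :
    φ (plaqV c p) = plaqOfBonds (AxialTree.ofCfg (r := s) (fun b μ => φ (c b μ))) p := by
  simp only [plaqV, map_add, map_sub]
  rfl

/-- The same through the `k`-fold linear cascade `L^k`. [cite: Federbush1987PhaseCellVI, (24) p. 22; Federbush1986PhaseCellI,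
(1.11) p. 324] -/
theorem apply_plaqV_iterate_avStep [Module ℝ V] (φ : V →ₗ[ℝ] ℝ) (k : ℕ) (c : Cfg V) {s : ℕ} (p : Plaq s) :
    φ (plaqV (avStep^[k] c) p)
      = plaqOfBonds (AxialTree.ofCfg (r := s) (AxialTree.avStep^[k] (fun b μ => φ (c b μ)))) p := by
  rw [apply_plaqV]
  have h : (fun b μ => φ ((avStep^[k] c) b μ) : AxialTree.Cfg) = AxialTree.avStep^[k] (fun b μ => φ (c b μ)) := by
    funext b μ
    exact apply_iterate_avStep φ k c b μ
  rw [h]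

end Algebra

end AxialTreeV

/-! ### The real averaging as the `V = ℝ` instance of the module-valued one (linearity transport) -/

/-- `AxialTree.avStep = AxialTreeV.avStep` on real configurations. [cite: Federbush1986PhaseCellI, (1.10) p. 323] -/
theorem AxialTree.avStep_eq_avStepV (F : AxialTree.Cfg) : AxialTree.avStep F = AxialTreeV.avStep (V := ℝ) F := by
  funext b μ
  have h := AxialTreeV.apply_avStep (LinearMap.id : ℝ →ₗ[ℝ] ℝ) F b μ
  simpa using h.symm

/-- The same for the iterates `L^k`. [cite: Federbush1986PhaseCellI, (1.11) p. 324] -/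
theorem AxialTree.iterate_avStep_eq (k : ℕ) (F : AxialTree.Cfg) :
    AxialTree.avStep^[k] F = (AxialTreeV.avStep (V := ℝ))^[k] F := by
  funext b μ
  have h := AxialTreeV.apply_iterate_avStep (LinearMap.id : ℝ →ₗ[ℝ] ℝ) k F b μ
  simpa using h.symm

/-- `plaqOfBonds ∘ ofCfg` is the real `plaqV`. [cite: Federbush1986PhaseCellI, (1.4) p. 322] -/
theorem plaqOfBonds_ofCfg_eq_plaqV (F : AxialTree.Cfg) {s : ℕ} (p : Plaq s) :
    plaqOfBonds (AxialTree.ofCfg (r := s) F) p = AxialTreeV.plaqV (V := ℝ) F p := rfl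

namespace AxialTreeV

/-- **(1.5), abelian, `V`-valued — the tree legs cancel around a plaquette**: the plaquette variable of `avStep F` at the
coarse plaquette `(b; i, j)` is `16⁻¹ Σ_δ` of the sum of the plaquette variables of `F` around the FOUR fine plaquettes of
the `2×2` square at `2b + δ` (by duality from `AxialTree.plaqOfBonds_avStep`). [cite: Federbush1986PhaseCellI, (1.4)–(1.5)
p. 322; «consistency requirements, of Balaban averaging» p. 324; Federbush1987PhaseCellVI, (24) p. 22] -/
theorem plaqV_avStep {V : Type*} [NormedAddCommGroup V] [NormedSpace ℝ V] (F : Cfg V) {s : ℕ} (b : Fin 4 → ℤ)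
    (i j : Fin 4) :
    plaqV (avStep F) (⟨b, i, j⟩ : Plaq s)
      = (1 / 16 : ℝ) • ∑ δ : Fin 4 → Bool,
        (plaqV F (⟨AxialTree.twice b + AxialTree.hat δ, i, j⟩ : Plaq (s + 1))
          + plaqV F (⟨AxialTree.twice b + AxialTree.hat δ + Pi.single i 1, i, j⟩ : Plaq (s + 1))
          + plaqV F (⟨AxialTree.twice b + AxialTree.hat δ + Pi.single j 1, i, j⟩ : Plaq (s + 1))
          + plaqV F (⟨AxialTree.twice b + AxialTree.hat δ + Pi.single i 1 + Pi.single j 1, i, j⟩ : Plaq (s + 1))) := by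
  refine (SeparatingDual.eq_iff_forall_dual_eq (R := ℝ)).2 fun φ => ?_
  have h1 := apply_plaqV_iterate_avStep (φ : V →ₗ[ℝ] ℝ) 1 F (⟨b, i, j⟩ : Plaq s)
  simp only [Function.iterate_one, ContinuousLinearMap.coe_coe] at h1
  rw [h1, AxialTree.plaqOfBonds_avStep]
  simp only [map_smul, map_sum, map_add, smul_eq_mul]
  congr 1
  refine Finset.sum_congr rfl fun δ _ => ?_
  have h2 : ∀ q : Plaq (s + 1), plaqOfBonds (AxialTree.ofCfg (r := s + 1) fun b μ => φ (F b μ)) q = φ (plaqV F q) :=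
    fun q => (apply_plaqV (φ : V →ₗ[ℝ] ℝ) F q).symm
  simp only [h2]

end AxialTreeV

/-! ## §2 Duality: `φ` through the potential, its derivatives and the integrals -/

section Duality

variable {V : Type*} [NormedAddCommGroup V] [NormedSpace ℝ V]

/-- `A_φ` is `C¹`. [cite: Federbush1987PhaseCellVI, Theorem 2 hypotheses p. 20] -/
theorem contDiff_dualPot (φ : V →L[ℝ] ℝ) {A : E4 → Fin 4 → V} (hA : ContDiff ℝ 1 A) : ContDiff ℝ 1 (dualPot φ A) :=
  contDiff_pi.2 fun μ => φ.contDiff.comp (contDiff_pi.1 hA μ)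

/-- `∂_ν(A_φ)_μ = φ(∂_νA_μ)`. [cite: Federbush1987PhaseCellVI, Theorem 2 hypotheses p. 20; Federbush1986PhaseCellI, (2.4)
p. 325] -/
theorem pd_dualPot (φ : V →L[ℝ] ℝ) {A : E4 → Fin 4 → V} (hA : ContDiff ℝ 1 A) (ν μ : Fin 4) (x : E4) :
    pd (dualPot φ A) ν μ x = φ (fderiv ℝ (fun y => A y μ) x (unitVec ν)) := by
  have hd : DifferentiableAt ℝ (fun y => A y μ) x := differentiableAt_pi.mp ((hA.differentiable (by simp)) x) μ
  have h : HasFDerivAt (fun y => φ (A y μ)) (φ.comp (fderiv ℝ (fun y => A y μ) x)) x :=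
    φ.hasFDerivAt.comp x hd.hasFDerivAt
  unfold pd dualPot
  rw [h.fderiv]
  rfl

/-- `|∂(A_φ)| ≤ ‖φ‖·B₂`. [cite: Federbush1987PhaseCellVI, Theorem 2 hypotheses p. 20] -/
theorem abs_pd_dualPot_le (φ : V →L[ℝ] ℝ) {A : E4 → Fin 4 → V} (hA : ContDiff ℝ 1 A) {B₂ : ℝ}
    (hB₂ : ∀ x μ ν, ‖fderiv ℝ (fun y => A y μ) x (unitVec ν)‖ ≤ B₂) (x : E4) (ν μ : Fin 4) :
    |pd (dualPot φ A) ν μ x| ≤ ‖φ‖ * B₂ := by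
  rw [pd_dualPot φ hA, ← Real.norm_eq_abs]
  exact (φ.le_opNorm _).trans (mul_le_mul_of_nonneg_left (hB₂ x μ ν) (norm_nonneg _))

/-- `φ(∫_e A) = ∫_e A_φ`. [cite: Federbush1987PhaseCellVI, (7) p. 19, (14) p. 21] -/
theorem apply_lineIntV [CompleteSpace V] (φ : V →L[ℝ] ℝ) {A : E4 → Fin 4 → V} (hA : Continuous A) (x : E4) (i : Fin 4) (ℓ : ℝ) :
    φ (lineIntV A x i ℓ) = lineInt (dualPot φ A) x i ℓ := by
  unfold lineIntV lineInt dualPot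
  have hc : Continuous fun t : ℝ => A (x + t • unitVec i) i :=
    (continuous_apply i).comp (hA.comp (continuous_const.add (continuous_id.smul continuous_const)))
  exact (φ.intervalIntegral_comp_comm (hc.intervalIntegrable _ _)).symm

/-- `φ(∮ A) = ∮ A_φ`. [cite: Federbush1987PhaseCellVI, (10) p. 20; Federbush1986PhaseCellI, (1.13) p. 324] -/
theorem apply_loopIntV [CompleteSpace V] (φ : V →L[ℝ] ℝ) {A : E4 → Fin 4 → V} (hA : Continuous A) (x : E4) (i j : Fin 4) (ℓ : ℝ) :
    φ (loopIntV A x i j ℓ) = loopInt (dualPot φ A) x i j ℓ := by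
  simp only [loopIntV, loopInt, map_add, map_sub, apply_lineIntV φ hA]

/-- [folklore] -/
private theorem continuous_mkPt₅ : Continuous fun u : Fin 4 → ℝ => (mkPt u : E4) := by
  unfold mkPt; exact PiLp.continuous_toLp 2 _

/-- The `u`-integrand of `plaqFunctionalV` is continuous. [folklore] -/
private theorem continuous_loopIntV_base {A : E4 → Fin 4 → V} (hA : Continuous A) (x : E4) (i j : Fin 4) (ℓ L : ℝ) :
    Continuous fun u : Fin 4 → ℝ => loopIntV A (x + ℓ • mkPt u) i j L := by
  have hline : ∀ (c : E4) (μ : Fin 4), Continuous fun u : Fin 4 → ℝ => lineIntV A (x + ℓ • mkPt u + c) μ L := by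
    intro c μ
    unfold lineIntV
    exact intervalIntegral.continuous_parametric_intervalIntegral_of_continuous'
      (f := fun (u : Fin 4 → ℝ) (t : ℝ) => A (x + ℓ • mkPt u + c + t • unitVec μ) μ)
      (((continuous_apply μ).comp hA).comp
        ((((continuous_const.add (continuous_mkPt₅.const_smul ℓ)).add continuous_const).comp continuous_fst).add
          (continuous_snd.smul continuous_const))) 0 L
  unfold loopIntV
  have h1 := hline 0 i
  have h4 := hline 0 j
  simp only [add_zero] at h1 h4
  exact ((h1.add (hline _ j)).sub (hline _ i)).sub h4

/-- `φ(P_s[A](p)) = P_s[A_φ](p)`. [cite: Federbush1986PhaseCellI, (1.13)–(1.14) p. 324; Federbush1987PhaseCellVI, (14)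
p. 21] -/
theorem apply_plaqFunctionalV [CompleteSpace V] (φ : V →L[ℝ] ℝ) {A : E4 → Fin 4 → V} (hA : Continuous A) {s : ℕ} (p : Plaq s) :
    φ (plaqFunctionalV s A p) = plaqFunctional s (dualPot φ A) p := by
  unfold plaqFunctionalV plaqFunctional
  have hint : Integrable (fun u : Fin 4 → ℝ => loopIntV A (p.src + latLen s • mkPt u) p.dir₁ p.dir₂ (latLen s))
      (volume.restrict (Icc (0 : Fin 4 → ℝ) 1)) :=
    (continuous_loopIntV_base hA _ _ _ _ _).continuousOn.integrableOn_compact isCompact_Icc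
  rw [← φ.integral_comp_comm hint]
  simp only [apply_loopIntV φ hA]

/-- The line data of the top datum seen through `φ` are the real line data of `A_φ`. [cite: Federbush1987PhaseCellVI, (7)
p. 19, (14) p. 21] -/
theorem apply_toCfg_lineData [CompleteSpace V] (φ : V →L[ℝ] ℝ) {A : E4 → Fin 4 → V} (hA : Continuous A) (r : ℕ) :
    (fun b μ => φ (AxialTreeV.toCfg (lineData A r) b μ) : AxialTree.Cfg)
      = AxialTree.toCfg (fun e : Edge r => lineInt (dualPot φ A) e.src e.dir (latLen r)) := by
  funext b μ
  simp only [AxialTreeV.toCfg, AxialTree.toCfg, lineData, apply_lineIntV φ hA]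

end Duality

/-! ## §3 The real estimate: plain line data against I's tent-smeared datum, and the cascade -/

/-- `|∫₀^ℓ A_d(x + te_d) dt − ℓ·A_d(x)| ≤ 2B₂ℓ²` for a real `C¹` field with (2.4). [cite: Federbush1986PhaseCellI, (2.4)
p. 325, (2.10) p. 326] -/
theorem abs_lineInt_sub_mul_le (A : E4 → Fin 4 → ℝ) (hA : ContDiff ℝ 1 A) {B₂ : ℝ} (hB : ∀ x ν μ, |pd A ν μ x| ≤ B₂)
    (x : E4) (d : Fin 4) {ℓ : ℝ} (hℓ : 0 ≤ ℓ) : |lineInt A x d ℓ - ℓ * A x d| ≤ 2 * B₂ * ℓ ^ 2 := by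
  have hc : Continuous fun t : ℝ => A (x + t • unitVec d) d :=
    (continuous_apply d).comp (hA.continuous.comp (continuous_const.add (continuous_id.smul continuous_const)))
  have h1 : lineInt A x d ℓ - ℓ * A x d = ∫ t in (0 : ℝ)..ℓ, (A (x + t • unitVec d) d - A x d) := by
    unfold lineInt
    rw [intervalIntegral.integral_sub (hc.intervalIntegrable _ _) intervalIntegrable_const,
      intervalIntegral.integral_const, sub_zero, smul_eq_mul]
  rw [h1]
  have h2 := intervalIntegral.norm_integral_le_of_norm_le_const (a := (0 : ℝ)) (b := ℓ) (C := 2 * B₂ * ℓ)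
    (f := fun t => A (x + t • unitVec d) d - A x d) (fun t ht => by
      rw [Set.uIoc_of_le hℓ] at ht
      rw [Real.norm_eq_abs]
      have hmv := abs_sub_le_of_pd_le A hA hB d x (x + t • unitVec d)
      have hn : ‖x + t • unitVec d - x‖ = |t| := by
        rw [add_sub_cancel_left, norm_smul, Real.norm_eq_abs]
        unfold unitVec; simp
      rw [hn, abs_of_pos ht.1] at hmv
      have hB0 : 0 ≤ B₂ := le_trans (abs_nonneg _) (hB 0 0 0)
      calc |A (x + t • unitVec d) d - A x d| ≤ 2 * B₂ * t := hmv
        _ ≤ 2 * B₂ * ℓ := by gcongr; exact ht.2)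
  rw [Real.norm_eq_abs, sub_zero, abs_of_nonneg hℓ] at h2
  calc _ ≤ 2 * B₂ * ℓ * ℓ := h2
    _ = 2 * B₂ * ℓ ^ 2 := by ring

/-- **The two level-`r` data differ by `O(ℓ_r²)`**: VI's plain line integral (7) vs I's tent average (2.1) of the same edge,
`|λ_r(e) − approxTop_r(e)| ≤ 22B₂ℓ_r²`. [cite: Federbush1987PhaseCellVI, (7) p. 19; Federbush1986PhaseCellI, (2.1), (2.10)
p. 325–326] -/
theorem abs_lineData_sub_approxTop_le (A : E4 → Fin 4 → ℝ) (hA : ContDiff ℝ 1 A) {B₂ : ℝ}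
    (hB : ∀ x ν μ, |pd A ν μ x| ≤ B₂) (r : ℕ) (e : Edge r) :
    |lineInt A e.src e.dir (latLen r) - approxTop r A e| ≤ 22 * B₂ * latLen r ^ 2 := by
  have hℓ : 0 ≤ latLen r := (latLen_pos r).le
  have h1 := abs_lineInt_sub_mul_le A hA hB e.src e.dir hℓ
  obtain ⟨b, μ⟩ := e
  have hsrc : (⟨b, μ⟩ : Edge r).src = (⟨b, μ⟩ : Edge r).src + latLen r • mkPt (0 : Fin 4 → ℝ) := by
    have : (mkPt (0 : Fin 4 → ℝ) : E4) = 0 := by unfold mkPt; simp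
    rw [this, smul_zero, add_zero]
  have h2 := abs_approxTop_sub_const_le A hA hB _ 0 (fun i => by simp) b μ hsrc
  rw [abs_sub_comm] at h2
  calc |lineInt A (Edge.src ⟨b, μ⟩) μ (latLen r) - approxTop r A ⟨b, μ⟩|
      ≤ |lineInt A (Edge.src ⟨b, μ⟩) μ (latLen r) - latLen r * A (Edge.src ⟨b, μ⟩) μ|
        + |latLen r * A (Edge.src ⟨b, μ⟩) μ - approxTop r A ⟨b, μ⟩| := abs_sub_le _ _ _
    _ ≤ 2 * B₂ * latLen r ^ 2 + 20 * B₂ * latLen r ^ 2 := add_le_add h1 h2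
    _ = 22 * B₂ * latLen r ^ 2 := by ring

/-- **Real rate**: the plaquette values of the axial-tree cascade of the PLAIN line data differ from the continuum
functional (1.13) by `≤ 792·B₂·ℓ_s·ℓ_{r₀}` (exactness for the tent data + (2.9)-Lipschitz transport of the `O(ℓ_{r₀}²)`
top difference). [cite: Federbush1986PhaseCellI, (1.13)–(1.14) p. 324, (2.9)–(2.12) p. 326; Federbush1987PhaseCellVI, (7)
p. 19, (24) p. 22] -/
theorem abs_plaq_av_lineData_sub_plaqFunctional_le (A : E4 → Fin 4 → ℝ) (hA : ContDiff ℝ 1 A) {B₂ : ℝ}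
    (hB : ∀ x ν μ, |pd A ν μ x| ≤ B₂) {s r₀ : ℕ} (hs : s ≤ r₀) (p : Plaq s) :
    |plaqOfBonds (axialTreeAveraging.av s r₀ (fun e : Edge r₀ => lineInt A e.src e.dir (latLen r₀))) p
        - plaqFunctional s A p| ≤ 792 * B₂ * latLen s * latLen r₀ := by
  have hB0 : 0 ≤ B₂ := le_trans (abs_nonneg _) (hB 0 0 0)
  set a : Edge r₀ → ℝ := fun e => lineInt A e.src e.dir (latLen r₀) with ha
  set a' : Edge r₀ → ℝ := approxTop r₀ A with ha'
  -- exactness for the tent data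
  have hex : plaqOfBonds (axialTreeAveraging.av s r₀ a') p = plaqFunctional s A p :=
    plaqOfBonds_bondApprox A hA.continuous hs p
  have hta : AxialTree.toCfg a = AxialTreeV.toCfg (V := ℝ) a := rfl
  have hta' : AxialTree.toCfg a' = AxialTreeV.toCfg (V := ℝ) a' := rfl
  rw [← hex, axialTreeAveraging_av_of_le hs, axialTreeAveraging_av_of_le hs, AxialTree.iterate_avStep_eq,
    AxialTree.iterate_avStep_eq, plaqOfBonds_ofCfg_eq_plaqV, plaqOfBonds_ofCfg_eq_plaqV, hta, hta',
    ← AxialTreeV.plaqV_sub, ← AxialTreeV.iterate_avStep_sub]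
  -- the top difference
  set M : ℝ := 22 * B₂ * latLen r₀ ^ 2 with hM
  have hM0 : 0 ≤ M := by positivity
  set d : AxialTreeV.Cfg ℝ := AxialTreeV.toCfg (V := ℝ) a - AxialTreeV.toCfg (V := ℝ) a' with hd
  have hdiff : ∀ b μ, ‖d b μ‖ ≤ M := by
    intro b μ
    rw [hd, Pi.sub_apply, Pi.sub_apply, Real.norm_eq_abs]
    exact abs_lineData_sub_approxTop_le A hA hB r₀ ⟨b, μ⟩
  have hL := AxialTreeV.norm_iterate_avStep_le d hM0 hdiff (r₀ - s)
  set G := (AxialTreeV.avStep (V := ℝ))^[r₀ - s] d with hG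
  have hGe : ∀ b μ, |G b μ| ≤ 9 * 2 ^ (r₀ - s) * M := fun b μ => by rw [← Real.norm_eq_abs]; exact hL b μ
  have h4 : |AxialTreeV.plaqV G p| ≤ 4 * (9 * 2 ^ (r₀ - s) * M) := by
    unfold AxialTreeV.plaqV
    calc _ ≤ |G p.base p.dir₁ + G (p.base + Pi.single p.dir₁ 1) p.dir₂ - G (p.base + Pi.single p.dir₂ 1) p.dir₁|
          + |G p.base p.dir₂| := abs_sub _ _
      _ ≤ |G p.base p.dir₁ + G (p.base + Pi.single p.dir₁ 1) p.dir₂| + |G (p.base + Pi.single p.dir₂ 1) p.dir₁|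
          + |G p.base p.dir₂| := by gcongr; exact abs_sub _ _
      _ ≤ |G p.base p.dir₁| + |G (p.base + Pi.single p.dir₁ 1) p.dir₂| + |G (p.base + Pi.single p.dir₂ 1) p.dir₁|
          + |G p.base p.dir₂| := by gcongr; exact abs_add_le _ _
      _ ≤ 9 * 2 ^ (r₀ - s) * M + 9 * 2 ^ (r₀ - s) * M + 9 * 2 ^ (r₀ - s) * M + 9 * 2 ^ (r₀ - s) * M := by
          gcongr <;> exact hGe _ _
      _ = 4 * (9 * 2 ^ (r₀ - s) * M) := by ring
  have hpow : (2 : ℝ) ^ (r₀ - s) * latLen r₀ = latLen s := two_pow_mul_latLen hs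
  calc |AxialTreeV.plaqV G p| ≤ 4 * (9 * 2 ^ (r₀ - s) * M) := h4
    _ = 792 * B₂ * ((2 : ℝ) ^ (r₀ - s) * latLen r₀) * latLen r₀ := by rw [hM]; ring
    _ = 792 * B₂ * latLen s * latLen r₀ := by rw [hpow]

/-! ## §4 The `V`-valued rate and the limit (Hahn–Banach), and the `BlockSpinSystem` form -/

namespace AxialTreeV

variable {V : Type*} [NormedAddCommGroup V] [NormedSpace ℝ V] [CompleteSpace V]

/-- **`V`-valued rate.**  For a `C¹` potential with values in a complete normed space and axis derivatives bounded by `B₂`,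
the plaquette variable of the linear cascade `L^{r₀−s}λ_{r₀}` of the top datum (7) at a level-`s` plaquette differs from
the continuum plaquette functional (1.13) by `≤ 792·B₂·ℓ_s·ℓ_{r₀}`. [cite: Federbush1987PhaseCellVI, (7) p. 19, (11)–(12)
p. 20, (24) p. 22, p. 23; Federbush1986PhaseCellI, (1.13)–(1.14) p. 324, (2.9)–(2.12) p. 326] -/
theorem norm_plaqV_cascade_lineData_sub_le (A : E4 → Fin 4 → V) (hA : ContDiff ℝ 1 A) {B₂ : ℝ}
    (hB₂ : ∀ x μ ν, ‖fderiv ℝ (fun y => A y μ) x (unitVec ν)‖ ≤ B₂) {s r₀ : ℕ} (hs : s ≤ r₀) (p : Plaq s) :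
    ‖plaqV (avStep^[r₀ - s] (toCfg (lineData A r₀))) p - plaqFunctionalV s A p‖ ≤ 792 * B₂ * latLen s * latLen r₀ := by
  have hB0 : 0 ≤ B₂ := (norm_nonneg _).trans (hB₂ 0 0 0)
  have hℓs := (latLen_pos s).le
  have hℓr := (latLen_pos r₀).le
  refine NormedSpace.norm_le_dual_bound ℝ _ (by positivity) fun φ => ?_
  have hφ := abs_plaq_av_lineData_sub_plaqFunctional_le (dualPot φ A) (contDiff_dualPot φ hA)
    (fun x ν μ => abs_pd_dualPot_le φ hA hB₂ x ν μ) hs p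
  rw [axialTreeAveraging_av_of_le hs, ← apply_toCfg_lineData φ hA.continuous r₀] at hφ
  rw [map_sub, Real.norm_eq_abs]
  have h1 := apply_plaqV_iterate_avStep (φ : V →ₗ[ℝ] ℝ) (r₀ - s) (toCfg (lineData A r₀)) p
  have h2 := apply_plaqFunctionalV φ hA.continuous p
  simp only [ContinuousLinearMap.coe_coe] at h1
  rw [h1, h2]
  calc _ ≤ 792 * (‖φ‖ * B₂) * latLen s * latLen r₀ := hφ
    _ = 792 * B₂ * latLen s * latLen r₀ * ‖φ‖ := by ring

/-- [folklore] -/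
private theorem tendsto_latLen₅ : Tendsto latLen atTop (𝓝 0) := by
  unfold latLen; exact tendsto_inv_atTop_zero.comp (tendsto_pow_atTop_atTop_of_one_lt one_lt_two)

/-- **The limit**: the plaquette variables of the linear cascade of the top datum converge to the continuum plaquette
functional (1.13), `plaq(L^{r₀−s}λ_{r₀})(p) → P_s(p)` as `r₀ → ∞`. [cite: Federbush1987PhaseCellVI, (11)–(12) p. 20, (24)
p. 22; Federbush1986PhaseCellI, (1.13)–(1.14) p. 324, (2.12) p. 326] -/
theorem tendsto_plaqV_cascade_lineData (A : E4 → Fin 4 → V) (hA : ContDiff ℝ 1 A) {B₂ : ℝ}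
    (hB₂ : ∀ x μ ν, ‖fderiv ℝ (fun y => A y μ) x (unitVec ν)‖ ≤ B₂) (s : ℕ) (p : Plaq s) :
    Tendsto (fun r₀ => plaqV (avStep^[r₀ - s] (toCfg (lineData A r₀))) p) atTop (𝓝 (plaqFunctionalV s A p)) := by
  have hbound : ∀ᶠ r₀ in atTop,
      ‖plaqV (avStep^[r₀ - s] (toCfg (lineData A r₀))) p - plaqFunctionalV s A p‖ ≤ 792 * B₂ * latLen s * latLen r₀ :=
    Filter.eventually_atTop.2 ⟨s, fun r₀ hr₀ => norm_plaqV_cascade_lineData_sub_le A hA hB₂ hr₀ p⟩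
  have hlim : Tendsto (fun r₀ => 792 * B₂ * latLen s * latLen r₀) atTop (𝓝 0) := by
    simpa using tendsto_latLen₅.const_mul (792 * B₂ * latLen s)
  exact tendsto_sub_nhds_zero_iff.1 (squeeze_zero_norm' hbound hlim)

end AxialTreeV

namespace BlockSpinSystem

variable (S : BlockSpinSystem)

/-- The top datum (7) `logData` is `lineData`. [cite: Federbush1987PhaseCellVI, (7) p. 19, (11) p. 20] -/
theorem logData_eq_lineData (A : S.Potential) (r : ℕ) : S.logData A r = lineData A r := rfl

/-- **For Federbush's scheme (quantitative form).**  The plaquette variables of the LINEAR block-spin cascade `F^L`-iterate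
(= axial-tree average, `FL_vars_eq_avStep`) of the logarithmic top data (7) at level `r₀` differ from the 𝔤-valued
cube-averaged flux (1.13) at a level-`s` plaquette by `≤ 792·B₂·ℓ_s·ℓ_{r₀}`. [cite: Federbush1987PhaseCellVI, (7) p. 19,
(11)–(12) p. 20, (14) p. 21, (24) p. 22, Theorem 2 p. 20; Federbush1986PhaseCellI, (1.13)–(1.14) p. 324] -/
theorem norm_plaq_linearCascade_logData_sub_le (A : S.Potential) (hA : ContDiff ℝ 1 A) {B₂ : ℝ}
    (hB₂ : ∀ x μ ν, ‖fderiv ℝ (fun y => A y μ) x (unitVec ν)‖ ≤ B₂) {s r₀ : ℕ} (hs : s ≤ r₀) (p : Plaq s) :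
    ‖AxialTreeV.plaqV (AxialTreeV.avStep^[r₀ - s] (AxialTreeV.toCfg (S.logData A r₀))) p - plaqFunctionalV s A p‖
      ≤ 792 * B₂ * latLen s * latLen r₀ :=
  AxialTreeV.norm_plaqV_cascade_lineData_sub_le A hA hB₂ hs p

/-- **For Federbush's scheme (the limit requested for Theorem 2).**  `plaq(F^L-cascade of logData_{r₀})(p) → P_s(p)` as
`r₀ → ∞`, for every `C¹` potential with bounded axis derivatives. [cite: Federbush1987PhaseCellVI, (7) p. 19, (11)–(12)
p. 20, (24) p. 22, Theorem 2 p. 20; Federbush1986PhaseCellI, (1.13)–(1.14) p. 324] -/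
theorem tendsto_plaq_linearCascade_logData (A : S.Potential) (hA : ContDiff ℝ 1 A) {B₂ : ℝ}
    (hB₂ : ∀ x μ ν, ‖fderiv ℝ (fun y => A y μ) x (unitVec ν)‖ ≤ B₂) (s : ℕ) (p : Plaq s) :
    Tendsto (fun r₀ => AxialTreeV.plaqV (AxialTreeV.avStep^[r₀ - s] (AxialTreeV.toCfg (S.logData A r₀))) p) atTop
      (𝓝 (plaqFunctionalV s A p)) :=
  AxialTreeV.tendsto_plaqV_cascade_lineData A hA hB₂ s p

end BlockSpinSystem

end

end Literature.MathematicalPhysics.QuantumFieldTheory.Federbush1986
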